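import Summits.RiemannHypothesis.RiemannHypothesis.Theorems.WeilGroundStateArchimedeanWindowSimpleEvenTrial1
import Mathlib.Analysis.SpecialFunctions.Trigonometric.Series
import Mathlib.Analysis.Calculus.Deriv.MeanValue
import HarnessLib

/-!
# `ArchimedeanWindowSimpleEven` — the trial function, II: elementary inequalities

The archimedean jump density `ρ(t) = e^{t/2}/(2 sinh t) = e^{-t/2}/(1 − e^{-2t})` against the
increment weight: `2t ρ(t) ≤ e^{-t/2}(1 + t + t²/3)` (the `(2,2)`-Padé/Bernoulli bound
`x/(1 − e^{-x}) ≤ 1 + x/2 + x²/12`, proved by two monotonicity steps), a Taylor majorant of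
`e^{-t/2}`, `e^{-1/3} ≤ 3583/5000`, and the pole weight `cosh(x/2) ≤ 1 + (9/71)x²` on `9x² ≤ 1`.

Route `RiemannHypothesis/WeilGroundState`, item `ArchimedeanWindowSimpleEven` (stmt-RiemannHypothesis-1529).
See `WeilGroundStateArchimedeanWindowSimpleEvenGapDefs.lean` for the certificate format, the data and the
overall plan (LOWER bounds by the gap certificate `weilGapCert`, UPPER bound `ε((log 2)/2) ≤ 3/200` by the
trial function `trialFun`).
-/

namespace Summit.RiemannHypothesis.RiemannHypothesis.Theorems.WeilGroundState

open Literature.NumberTheory.LFunctions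

/-! ## Elementary inequalities for the archimedean density and the pole weight -/

section Ineq

open Real Finset MeasureTheory Set Filter

/-- If `f 0 = 0` and `f' ≥ 0` on `[0, ∞)` then `f ≥ 0` on `[0, ∞)`. [folklore] -/
theorem nonneg_of_hasDerivAt_nonneg {f f' : ℝ → ℝ} (hf : ∀ x, HasDerivAt f (f' x) x) (h0 : f 0 = 0)
    (hpos : ∀ x, 0 ≤ x → 0 ≤ f' x) {x : ℝ} (hx : 0 ≤ x) : 0 ≤ f x := by
  have hmono : MonotoneOn f (Ici 0) :=
    monotoneOn_of_deriv_nonneg (convex_Ici 0) (fun y _ ↦ (hf y).continuousAt.continuousWithinAt)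
      (fun y _ ↦ (hf y).differentiableAt.differentiableWithinAt) fun y hy ↦ by
        rw [interior_Ici] at hy
        rw [(hf y).deriv]
        exact hpos y (le_of_lt hy)
  have := hmono (self_mem_Ici (a := (0 : ℝ))) hx hx
  rwa [h0] at this

/-- Derivative of `x ↦ e^{-x} (a + b x + c x²)`. [folklore] -/
theorem hasDerivAt_exp_neg_mul_quad (a b c y : ℝ) :
    HasDerivAt (fun x : ℝ ↦ Real.exp (-x) * (a + b * x + c * x ^ 2))
      (Real.exp (-y) * (-(a + b * y + c * y ^ 2) + (b + 2 * c * y))) y := by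
  have he : HasDerivAt (fun x : ℝ ↦ Real.exp (-x)) (-Real.exp (-y)) y := by
    simpa using (hasDerivAt_id y).neg.exp
  have hp : HasDerivAt (fun x : ℝ ↦ a + b * x + c * x ^ 2) (b + 2 * c * y) y := by
    have h := ((hasDerivAt_const y a).add ((hasDerivAt_id y).const_mul b)).add
      ((hasDerivAt_pow 2 y).const_mul c)
    refine (h.congr_deriv ?_).congr_of_eventuallyEq (Eventually.of_forall fun x ↦ ?_)
    · simp only [zero_add, mul_one, Nat.cast_ofNat, Nat.add_one_sub_one, pow_one]; ring
    · simp
  refine ((he.mul hp).congr_deriv ?_).congr_of_eventuallyEq (Eventually.of_forall fun x ↦ ?_)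
  · ring
  · simp

/-- The Bernoulli-type bound `e^{-x}(1 + x/2 + x²/12) ≤ 1 − x/2 + x²/12` for `x ≥ 0`
(equivalently `x/(1 − e^{-x}) ≤ 1 + x/2 + x²/12`; the `(2,2)` Padé approximant of `e^{-x}`
lies above it). Proof: `w = rhs − lhs` has `w(0) = 0`, `w' = v`, `v(0) = 0`,
`v' = (1 − e^{-x}(1 + x + x²/2))/6 ≥ 0`. [folklore] -/
theorem exp_neg_mul_le_pade {x : ℝ} (hx : 0 ≤ x) :
    Real.exp (-x) * (1 + x / 2 + x ^ 2 / 12) ≤ 1 - x / 2 + x ^ 2 / 12 := by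
  set w : ℝ → ℝ := fun x ↦ (1 + -(1 / 2) * x + (1 / 12) * x ^ 2) -
    Real.exp (-x) * (1 + (1 / 2) * x + (1 / 12) * x ^ 2) with hw
  set v : ℝ → ℝ := fun x ↦ (-(1 / 2) + (1 / 6) * x + 0 * x ^ 2) +
    Real.exp (-x) * (1 / 2 + (1 / 3) * x + (1 / 12) * x ^ 2) with hv
  set v' : ℝ → ℝ := fun x ↦ (1 / 6) * (1 - Real.exp (-x) * (1 + x + x ^ 2 / 2)) with hv'
  have hpoly : ∀ (a b c y : ℝ), HasDerivAt (fun x : ℝ ↦ a + b * x + c * x ^ 2) (b + 2 * c * y) y := by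
    intro a b c y
    have h := ((hasDerivAt_const y a).add ((hasDerivAt_id y).const_mul b)).add
      ((hasDerivAt_pow 2 y).const_mul c)
    refine (h.congr_deriv ?_).congr_of_eventuallyEq (Eventually.of_forall fun x ↦ ?_)
    · simp only [zero_add, mul_one, Nat.cast_ofNat, Nat.add_one_sub_one, pow_one]; ring
    · simp
  have hwd : ∀ y, HasDerivAt w (v y) y := by
    intro y
    have h := (hpoly 1 (-(1 / 2)) (1 / 12) y).sub (hasDerivAt_exp_neg_mul_quad 1 (1 / 2) (1 / 12) y)
    refine (h.congr_deriv ?_).congr_of_eventuallyEq (Eventually.of_forall fun x ↦ ?_)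
    · rw [hv]; ring
    · rw [hw]; simp
  have hvd : ∀ y, HasDerivAt v (v' y) y := by
    intro y
    have h := (hpoly (-(1 / 2)) (1 / 6) 0 y).add (hasDerivAt_exp_neg_mul_quad (1 / 2) (1 / 3) (1 / 12) y)
    refine (h.congr_deriv ?_).congr_of_eventuallyEq (Eventually.of_forall fun x ↦ ?_)
    · rw [hv']; ring
    · rw [hv]; simp
  have hv'pos : ∀ y, 0 ≤ y → 0 ≤ v' y := by
    intro y hy
    rw [hv']
    have h1 := Real.quadratic_le_exp_of_nonneg hy
    have h2 : Real.exp (-y) * (1 + y + y ^ 2 / 2) ≤ 1 := by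
      rw [Real.exp_neg, inv_mul_le_iff₀ (Real.exp_pos y)]
      simpa using h1
    simp only
    linarith
  have hvpos : ∀ y, 0 ≤ y → 0 ≤ v y := fun y hy ↦
    nonneg_of_hasDerivAt_nonneg hvd (by rw [hv]; norm_num) hv'pos hy
  have hwpos := nonneg_of_hasDerivAt_nonneg hwd (by rw [hw]; norm_num) hvpos hx
  rw [hw] at hwpos
  simp only at hwpos
  linarith

/-- The archimedean density in the form `e^{-t/2}/(1 − e^{-2t})`. [folklore] -/
theorem weilArchDensity_eq (t : ℝ) :
    weilArchDensity t = Real.exp (-(t / 2)) / (1 - Real.exp (-(2 * t))) := by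
  unfold weilArchDensity
  have h1 : 2 * Real.sinh t = (1 - Real.exp (-(2 * t))) * Real.exp t := by
    rw [Real.sinh_eq, sub_mul, ← Real.exp_add]
    ring_nf
  have h2 : Real.exp (t / 2) = Real.exp (-(t / 2)) * Real.exp t := by
    rw [← Real.exp_add]; ring_nf
  rw [h1, h2, mul_div_mul_right _ _ (Real.exp_pos t).ne']

/-- **The density against the increment weight**: for `0 < t`,
`2t · e^{t/2}/(2 sinh t) ≤ e^{-t/2} (1 + t + t²/3)`. [folklore] -/
theorem two_mul_mul_weilArchDensity_le {t : ℝ} (ht : 0 < t) :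
    2 * t * weilArchDensity t ≤ Real.exp (-(t / 2)) * (1 + t + t ^ 2 / 3) := by
  rw [weilArchDensity_eq t]
  have hq : Real.exp (-(2 * t)) < 1 := Real.exp_lt_one_iff.2 (by linarith)
  have h1q : 0 < 1 - Real.exp (-(2 * t)) := by linarith
  have hpade := exp_neg_mul_le_pade (x := 2 * t) (by linarith)
  have hp' : Real.exp (-(2 * t)) * (1 + t + t ^ 2 / 3) ≤ 1 - t + t ^ 2 / 3 := by
    have e1 : (1 : ℝ) + 2 * t / 2 + (2 * t) ^ 2 / 12 = 1 + t + t ^ 2 / 3 := by ring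
    have e2 : (1 : ℝ) - 2 * t / 2 + (2 * t) ^ 2 / 12 = 1 - t + t ^ 2 / 3 := by ring
    rwa [e1, e2] at hpade
  have he : 0 < Real.exp (-(t / 2)) := Real.exp_pos _
  rw [show 2 * t * (Real.exp (-(t / 2)) / (1 - Real.exp (-(2 * t)))) =
    Real.exp (-(t / 2)) * (2 * t / (1 - Real.exp (-(2 * t)))) by ring]
  refine mul_le_mul_of_nonneg_left ?_ he.le
  rw [div_le_iff₀ h1q]
  nlinarith

/-- Taylor bound: `e^{-t/2} ≤ 1 − t/2 + t²/8 − t³/48 + t⁴/384 + t⁵/3200` for `0 ≤ t ≤ 2`. [folklore] -/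
theorem exp_neg_half_le {t : ℝ} (ht0 : 0 ≤ t) (ht2 : t ≤ 2) :
    Real.exp (-(t / 2)) ≤ 1 - t / 2 + t ^ 2 / 8 - t ^ 3 / 48 + t ^ 4 / 384 + t ^ 5 / 3200 := by
  have hx : |(-(t / 2))| ≤ 1 := by
    rw [abs_neg, abs_of_nonneg (by linarith)]
    linarith [ht2]
  have h := Real.exp_bound hx (n := 5) (by norm_num)
  have h' := (abs_sub_le_iff.1 h).1
  simp only [Finset.sum_range_succ, Finset.sum_range_zero, Nat.factorial] at h'
  rw [abs_neg, abs_of_nonneg (by linarith : 0 ≤ t / 2)] at h'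
  norm_num at h'
  nlinarith [h']

/-- `e^{-1/3} ≤ 3583/5000`. [folklore] -/
theorem exp_neg_third_le : Real.exp (-(1 / 3 : ℝ)) ≤ 3583 / 5000 := by
  have h := Real.sum_le_exp_of_nonneg (x := (1 / 3 : ℝ)) (by norm_num) 5
  simp only [Finset.sum_range_succ, Finset.sum_range_zero, Nat.factorial] at h
  norm_num at h
  rw [Real.exp_neg, inv_le_comm₀ (Real.exp_pos _) (by norm_num)]
  linarith

/-- The pole weight on the trial window: `cosh(x/2) ≤ 1 + (9/71) x²` for `9x² ≤ 1`. [folklore] -/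
theorem cosh_half_le {x : ℝ} (hx : 9 * x ^ 2 ≤ 1) : Real.cosh (x / 2) ≤ 1 + 9 / 71 * x ^ 2 := by
  have h1 := Real.cosh_le_exp_half_sq (x / 2)
  set s : ℝ := (x / 2) ^ 2 / 2 with hs
  have hs8 : s = x ^ 2 / 8 := by rw [hs]; ring
  have hs0 : 0 ≤ s := by positivity
  have hs1 : s ≤ 1 / 72 := by rw [hs8]; linarith
  -- e^s ≤ 1 + s e^s and e^s ≤ e^{1/72} ≤ 72/71
  have h2 : Real.exp s ≤ 1 + s * Real.exp s := by
    have h := Real.add_one_le_exp (-s)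
    have hpos := Real.exp_pos s
    have hmul := mul_le_mul_of_nonneg_right h hpos.le
    rw [add_mul, ← Real.exp_add, neg_add_cancel, Real.exp_zero, one_mul] at hmul
    linarith
  have h3 : Real.exp s ≤ 72 / 71 := by
    have h4 : Real.exp s ≤ Real.exp (1 / 72) := Real.exp_le_exp.2 hs1
    have h5 := Real.add_one_le_exp (-(1 / 72 : ℝ))
    rw [Real.exp_neg] at h5
    have h7 : (71 / 72 : ℝ) ≤ (Real.exp (1 / 72))⁻¹ := by norm_num at h5 ⊢; exact h5
    have h8 := (le_inv_comm₀ (by norm_num : (0 : ℝ) < 71 / 72) (Real.exp_pos _)).1 h7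
    have h9 : ((71 / 72 : ℝ))⁻¹ = 72 / 71 := by norm_num
    linarith [h8.trans_eq h9]
  calc Real.cosh (x / 2) ≤ Real.exp s := h1
    _ ≤ 1 + s * Real.exp s := h2
    _ ≤ 1 + s * (72 / 71) := by nlinarith
    _ = 1 + 9 / 71 * x ^ 2 := by rw [hs8]; ring

end Ineq

end Summit.RiemannHypothesis.RiemannHypothesis.Theorems.WeilGroundState
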